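import Literature.IUT.HodgeArakelov.LabelClassesOfCuspsR3
import Literature.IUT.HodgeArakelov.LabelClassesOfCuspsCor24iProofs

/-!
# [IUTchII] Cor 2.4 (i) for the printed family `□ ∈ {•t, ▶}`: `Cor24_i'` modulo the [IUTchI] §2 inputs (proofs, part 2)

S. Mochizuki, *Inter-universal Teichmüller theory II*, kurims manuscript (Dec. 2020), §2, Corollary 2.4 (i), pp. 69–71
([IUTchII] Cor 2.4 (i), kurims pp.69-71) [claim: Mochizuki2012, status: disputed] (D-0012 claim key; series status
DISPUTED).  PROOF-ONLY companion (abc-iut cell, seat abc-iut-w4-d012; node `IUTchII:Cor2.4(i)`) of the repair file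
`LabelClassesOfCuspsR3.lean` (`Cor24_family`, `Cor24_i'` — decl of record per abc-iut-L6-lead §F v1.8 (4)) over the part-1
proofs `LabelClassesOfCuspsCor24iProofs.lean` (p411807).  No new definitions.

* `cor24_family_tri`, `cor24_family_bt`, `cor24_family_iff` — the two printed groups `Π_{v▶}`, `Π_{v•t}` belong to the
  family; the family in label form (`H = Π_{v▶} ∨ ∃ t, H = Π_{v•t}`);
* `cor24_i'_iff_c_imp_a` — `Cor24_i'` is EQUIVALENT to: for every admissible `Π_{v□}`, the single implication
  (c) ⟹ (a) at `γ = 1` ("we may assume without loss of generality that `γ = 1`", p. 70), the implications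
  (a) ⟹ (b) ⟹ (c) being PROVED for every `H` in part 1;
* `inputA_of_conj_eq_of_normallyTerminal` — input (A) below reduced to the two [IUTchI] clauses it is made of, in the
  SHAPES of L5-t1's `Cor25Inertia.conj_eq_iff` (A1) and `TemperedNormallyTerminal`/`Cor23iv` (A2): PROVED;
  `cor24_i'_of_inputs'` — the discharge below with (A) in that two-clause form;
* `cor24_i'_of_inputs` — **`Cor24_i'` DISCHARGED MODULO the three printed [IUTchI] §2 inputs** of the proof on
  pp. 70–71, stated inline in the tower's language for the admissible groups (never asserted; L5 nodes `IUTchI:Cor2.5`,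
  `IUTchI:Cor2.3(vi)`, `IUTchI:Cor2.3(v)` — `StableCurveTemperedData.Cor25Inertia`/`Cor23vi`/`Cor23v`, abc-iut-L5-t1 — whose
  instantiation on a `PlusMinusTower` is L5↔L6 merge debt): (A) "`I^{γ'}_t ⊆ Π^±_v` implies `γ' ∈ Δ^±_v`"; (B) "`γ' ∈`
  the closure `Δ̂^±_{v□}`" (Cor. 2.3 (vi) on the finite index open subgroups); (C) "`Δ̂^±_{v□} ∩ Δ^±_v = Δ^±_{v□}`".

Nothing here takes a side on [IUTchIII] Cor. 3.12; typed ≠ discharged ((c) ⟹ (a) rests on (A)–(C), hypotheses here).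
-/

namespace Literature.IUT.HodgeArakelov

universe u

variable {S : BadPlaceSetting.{u}} {P : TopGroup.{u}} {T : TemperedCoverings S P}
  {D : EtaleThetaData S.toThetaSetting P}
  (Dec : SubgraphDecomposition S T D) (W : PlusMinusTower T) (C : CuspidalInertiaData W)
  {L : LabCuspStructure C} (Ld : LabelledDecomposition Dec L) (I : Subgroup W.Corhat)

/-- **IUTchII:Cor2.4** (kurims p. 69) `□ = ▶`: `Π_{v▶}` is admissible. [claim: Mochizuki2012, status: disputed]
(IUTchII §2 Cor 2.4, kurims p.69) -/
theorem cor24_family_tri : Cor24_family Dec Ld Dec.Ptri := Or.inl rfl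

/-- **IUTchII:Cor2.4** (kurims p. 69) `□ = •t`: `Π_{v•t}` is admissible, `t` the class of a cuspidal inertia group
`I ⊆ Π_v`. [claim: Mochizuki2012, status: disputed] (IUTchII §2 Cor 2.4, kurims p.69) -/
theorem cor24_family_bt (hI : C.IsCuspidalInertia W.piV I) :
    Cor24_family Dec Ld (Ld.Pbt (Quot.mk (labelRel C W.piV W.piPM) ⟨I, hI⟩)) :=
  Or.inr ⟨I, hI, rfl⟩

/-- **IUTchII:Cor2.4** (kurims p. 69 l. −8) the family in label form: `Cor24_family Dec Ld H` iff `H = Π_{v▶}` or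
`H = Π_{v•t}` for some `t ∈ LabCusp^±(Π_v)` (every label class has a cuspidal-inertia representative, `LabCuspPM` being a
quotient) — the form consumers of `Cor24_indices` / `Cor24_ii_iii'` may prefer. PROVED. [claim: Mochizuki2012, status: disputed]
(IUTchII §2 Cor 2.4, kurims p.69) -/
theorem cor24_family_iff {H : Subgroup P} :
    Cor24_family Dec Ld H ↔ H = Dec.Ptri ∨ ∃ t : LabCuspPM C W.piV W.piPM, H = Ld.Pbt t := by
  constructor
  · rintro (h | ⟨I, hI, h⟩)
    · exact Or.inl h
    · exact Or.inr ⟨_, h⟩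
  · rintro (h | ⟨t, h⟩)
    · exact Or.inl h
    · obtain ⟨⟨I, hI⟩, rfl⟩ := Quot.exists_rep t
      exact Or.inr ⟨I, hI, h⟩

/-- **IUTchII:Cor2.4(i)′**, reduction (p. 70: "(a) ⟹ (b) and (b) ⟹ (c) are immediate … it suffices to verify that
(c) ⟹ (a) … we may assume without loss of generality that `γ = 1`"): `Cor24_i'` ⟺ for every admissible `Π_{v□}` and
every `γ' ∈ Δ̂^±_v`, `I^{γ'} ⊆ Π^±_{v□}` implies `γ' ∈ Π^±_{v□}` (given `I` cuspidal inside `Δ_{v□}`).  PROVED (part 1's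
`cor24_i_iff_c_imp_a` at each `H`). [claim: Mochizuki2012, status: disputed] (IUTchII §2 Cor 2.4 (i), kurims p.70) -/
theorem cor24_i'_iff_c_imp_a :
    Literature.IUT.HodgeArakelov.Cor24_i' Dec W C Ld I ↔
      ∀ H : Subgroup P, Cor24_family Dec Ld H →
        C.IsCuspidalInertia W.piV I → I ≤ W.deltaBox H →
          ∀ γ' : W.Corhat, γ' ∈ W.pmHat ⊓ W.aug.ker →
            I.map (MulAut.conj γ').toMonoidHom ≤ W.pmBox H → γ' ∈ W.pmBox H :=
  forall_congr' fun H => forall_congr' fun _ => cor24_i_iff_c_imp_a W C H I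

/-- **IUTchII:Cor2.4(i)′ DISCHARGED MODULO the printed inputs** (proof pp. 70–71): if (A) [IUTchI] Cor. 2.5 — "the
inclusion `I^{γ'}_t ⊆ Π^±_{v□} ⊆ Π^±_v` implies that `γ' ∈ Δ^±_v`" — holds at the tower, and for every admissible `Π_{v□}`
(B) [IUTchI] Cor. 2.3 (vi) applied "to the various finite index open subgroups of `Δ^±_v`" gives "`γ' ∈ Δ̂^±_{v□}`" (the
closure) and (C) [IUTchI] Cor. 2.3 (v) gives "`Δ^±_{v□} = Δ̂^±_{v□} ∩ Δ^±_v`", then `Cor24_i'`.  The inputs are HYPOTHESES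
(L5 nodes at the tower; merge debt), never asserted.  PROVED from part 1's `cor24_i_of_inputs`.
[claim: Mochizuki2012, status: disputed] (IUTchII §2 Cor 2.4 (i), kurims pp.70-71) -/
theorem cor24_i'_of_inputs
    (h25 : ∀ γ' : W.Corhat, γ' ∈ W.pmHat ⊓ W.aug.ker →
      I.map (MulAut.conj γ').toMonoidHom ≤ W.piPM → γ' ∈ W.piPM)
    (h23 : ∀ H : Subgroup P, Cor24_family Dec Ld H →
      (∀ γ' : W.Corhat, γ' ∈ W.piPM ⊓ W.aug.ker →
          I.map (MulAut.conj γ').toMonoidHom ≤ W.pmBox H → γ' ∈ closure (W.deltaPmBox H : Set W.Corhat)) ∧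
        (∀ γ' : W.Corhat, γ' ∈ W.piPM ⊓ W.aug.ker →
          γ' ∈ closure (W.deltaPmBox H : Set W.Corhat) → γ' ∈ W.deltaPmBox H)) :
    Literature.IUT.HodgeArakelov.Cor24_i' Dec W C Ld I :=
  fun H hH => cor24_i_of_inputs W C H I h25 (h23 H hH).1 (h23 H hH).2

/-- **Input (A) of the printed proof, reduced to the two [IUTchI] clauses it consists of** (p. 70 l. −4: "by
[IUTchI], Corollary 2.5 [cf. also [IUTchI], Remark 2.5.2], the inclusion `I^{γ'}_t ⊆ Π^±_{v□} ⊆ Π^±_v` implies that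
`γ' ∈ Δ^±_v`"): in the tower's language, (A) follows from
(A1) [IUTchI] Cor. 2.5, p. 51, inertia clause, second half — "a `Π̂_X`-conjugate of `Π^tp_X` containing an inertia
group in `Π^tp_X` of a cusp equals `Π^tp_X`" (the shape of abc-iut-L5-t1's `StableCurveTemperedData.Cor25Inertia.conj_eq_iff`
for `X = X_v`, `Π^tp_X = Π^±_v`, `Π̂_X = Π̂^±_v`): `I ⊆ (Π^±_v)^γ ⟹ (Π^±_v)^γ = Π^±_v` for `γ ∈ Π̂^±_v`; and
(A2) [IUTchI] Rmk. 2.2.2 p. 46 / Cor. 2.3 (iv) p. 48 — `Π^tp_X` is normally terminal in `Π̂_X` (L5-t1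
`TemperedNormallyTerminal` / `Cor23iv`): `(Π^±_v)^γ = Π^±_v ⟹ γ ∈ Π^±_v`.  PROVED (apply (A1) to `γ'⁻¹`, then (A2)).
Both inputs are HYPOTHESES here (L5 nodes at the tower), never asserted. [claim: Mochizuki2012, status: disputed]
(IUTchII §2 Cor 2.4 (i), kurims p.70) -/
theorem inputA_of_conj_eq_of_normallyTerminal
    (hA1 : ∀ γ : W.Corhat, γ ∈ W.pmHat → I ≤ W.piPM.map (MulAut.conj γ).toMonoidHom →
      W.piPM.map (MulAut.conj γ).toMonoidHom = W.piPM)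
    (hA2 : ∀ γ : W.Corhat, γ ∈ W.pmHat → W.piPM.map (MulAut.conj γ).toMonoidHom = W.piPM → γ ∈ W.piPM) :
    ∀ γ' : W.Corhat, γ' ∈ W.pmHat ⊓ W.aug.ker →
      I.map (MulAut.conj γ').toMonoidHom ≤ W.piPM → γ' ∈ W.piPM := by
  intro γ' hγ' hc
  have hγ'hat : γ'⁻¹ ∈ W.pmHat := W.pmHat.inv_mem (Subgroup.mem_inf.mp hγ').1
  have hI : I ≤ W.piPM.map (MulAut.conj γ'⁻¹).toMonoidHom := by
    intro x hx
    rw [Subgroup.mem_map_equiv, MulAut.conj_symm_apply, inv_inv]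
    have hx' : γ' * x * γ'⁻¹ ∈ I.map (MulAut.conj γ').toMonoidHom := by
      rw [Subgroup.mem_map_equiv, MulAut.conj_symm_apply]
      have e : γ'⁻¹ * (γ' * x * γ'⁻¹) * γ' = x := by group
      rwa [e]
    exact hc hx'
  exact (Subgroup.inv_mem_iff W.piPM).mp (hA2 γ'⁻¹ hγ'hat (hA1 γ'⁻¹ hγ'hat hI))

/-- **IUTchII:Cor2.4(i)′ DISCHARGED MODULO the printed inputs, (A) in its two-clause form** (A1) = [IUTchI] Cor. 2.5
(conjugate containing a cuspidal inertia group), (A2) = normal terminality of `Π^±_v` in `Π̂^±_v`, and (B), (C) as in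
`cor24_i'_of_inputs`.  PROVED. [claim: Mochizuki2012, status: disputed] (IUTchII §2 Cor 2.4 (i), kurims pp.70-71) -/
theorem cor24_i'_of_inputs'
    (hA1 : ∀ γ : W.Corhat, γ ∈ W.pmHat → I ≤ W.piPM.map (MulAut.conj γ).toMonoidHom →
      W.piPM.map (MulAut.conj γ).toMonoidHom = W.piPM)
    (hA2 : ∀ γ : W.Corhat, γ ∈ W.pmHat → W.piPM.map (MulAut.conj γ).toMonoidHom = W.piPM → γ ∈ W.piPM)
    (h23 : ∀ H : Subgroup P, Cor24_family Dec Ld H →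
      (∀ γ' : W.Corhat, γ' ∈ W.piPM ⊓ W.aug.ker →
          I.map (MulAut.conj γ').toMonoidHom ≤ W.pmBox H → γ' ∈ closure (W.deltaPmBox H : Set W.Corhat)) ∧
        (∀ γ' : W.Corhat, γ' ∈ W.piPM ⊓ W.aug.ker →
          γ' ∈ closure (W.deltaPmBox H : Set W.Corhat) → γ' ∈ W.deltaPmBox H)) :
    Literature.IUT.HodgeArakelov.Cor24_i' Dec W C Ld I :=
  cor24_i'_of_inputs Dec W C Ld I (inputA_of_conj_eq_of_normallyTerminal W I hA1 hA2) h23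

/-- **IUTchII:Cor2.4(i)′** (a) ⟹ (b) ⟹ (c) for the printed family, PROVED unconditionally (p. 70 "immediate from the
definitions"; part 1's `cor24_i_b_of_a`, `cor24_i_c_of_b`, valid for every `H`). [claim: Mochizuki2012, status: disputed]
(IUTchII §2 Cor 2.4 (i), kurims p.70) -/
theorem cor24_i'_c_of_a {H : Subgroup P} (_hH : Cor24_family Dec Ld H) (hIΔ : I ≤ W.deltaBox H) (γ : W.Corhat)
    {γ' : W.Corhat} (ha : γ' ∈ W.deltaPmBox H) :
    I.map (MulAut.conj (γ * γ')).toMonoidHom ≤ (W.box H).map (MulAut.conj γ).toMonoidHom ∧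
      I.map (MulAut.conj (γ * γ')).toMonoidHom ≤ (W.pmBox H).map (MulAut.conj γ).toMonoidHom :=
  have hb := cor24_i_b_of_a W (hIΔ.trans (W.deltaBox_le_box H)) γ (Subgroup.mem_inf.mp ha).1
  ⟨hb, cor24_i_c_of_b W hb⟩

end Literature.IUT.HodgeArakelov
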